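import Mathlib
import Summits.AnomalousDissipation.AnomalousDissipation.Theses.WazewskiBlock
import Literature.Analysis.FluidPDE.GalerkinFlow
import Literature.Analysis.FluidPDE.CheskidovAssemblyTools
import Literature.Analysis.FunctionSpaces.TorusFourierCalculus
import Summits.AnomalousDissipation.AnomalousDissipation.Theorems.WazewskiBlockUniformGalerkinTrapSteadyFixedPoint

/-!
# Skeleton — line `SketchIdeator1` for the crux `WazewskiBlock.UniformGalerkinTrap`
# (stmt-AnomalousDissipation-10352), lead prover-line-stmt-AnomalousDissipation-10352-0, arm β (frozen faces)
# — re-owned verbatim by lead c4 (prover-line-stmt-AnomalousDissipation-10352-c4-0, 2026-08-17): 1 sorry = the bet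

Composition (kernel-checked; the only `sorry` left is the registered bet `stub_steadyLoudAllLevels`;
`stub_steadyFixedPoint` LANDED as p102267 and is imported):

  stub_steadyLoudAllLevels                      -- THE BET (card frozen-faces-coherent-structures, transfer C⁺_F,
        │                                          steady arm): for every 0 < ν ≤ ν₀ and every level N ≥ N₀(ν) a
        │                                          mean-zero STEADY Galerkin state of order N (tested steady Galerkin
        │                                          equations) with kineticEnergy ≤ E and work (f,U) ≥ ε₀.
        │   stub_steadyFixedPoint                 -- transfer stub (M): a steady Galerkin state is an equilibrium of the
        ▼          │                                 tree's semiflow `Torus.galerkinFlow ν f N`.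
  frozen_of_steady ◄─┘          (proved)
        ▼
  FrozenLoudAllLevels ──windowInvariantSets_of_frozen (proved: frozen power identity νZ = W ≤ ‖f‖₂√(2E))──►
  WindowInvariantSets ──(inlined in `UniformGalerkinTrap_of`; proved: `IsGalerkinMode.galerkinFlow_clauses`)──►
  Theses.WazewskiBlock.UniformGalerkinTrap      -- `UniformGalerkinTrap_of`

Diagnostics kept next to the skeleton (landed separately as `--supports` files): the landing decl is EQUIVALENT to the
crux (`WindowInvariantSets ↔ UniformGalerkinTrap`), and the bet implies the open sibling crux
`MirrorVariety.GalerkinSteadyZerothLaw` (stmt-AnomalousDissipation-2986).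
-/

noncomputable section

-- `Summit.<Summit>.<Problem>` is the tree's mandated summit-side namespace (CONVENTIONS §2); deliberate duplicate.
set_option linter.dupNamespace false

open MeasureTheory Set Filter
open scoped ENNReal NNReal InnerProductSpace

namespace Summit.AnomalousDissipation.AnomalousDissipation.Cruxes.UniformGalerkinTrap.SketchIdeator1

open Literature.Analysis.FunctionSpaces Literature.Analysis.FluidPDE

local notation "𝕋³" => UnitAddTorus (Fin 3)
local notation "E³" => EuclideanSpace ℝ (Fin 3)

/-! ## §0 Vocabulary (transparent) -/

/-- The crux's force clause: a mean-zero vector trigonometric polynomial of order `m`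
(first conjunct is `IsGalerkinMode m f` by `Iff.rfl`). -/
def IsTrigPolyForce (m : ℕ) (f : 𝕋³ → E³) : Prop :=
  (Torus.IsSmooth f ∧ Torus.IsDivFree f ∧ ∀ k : Fin 3 → ℤ, ((m : ℕ) : ℝ) ^ 2 < Torus.freqNormSq k →
    UnitAddTorus.mFourierCoeff (EuclideanSpace.complexify ∘ f) k = 0) ∧ Torus.HasZeroMean f

theorem isTrigPolyForce_iff (m : ℕ) (f : 𝕋³ → E³) :
    IsTrigPolyForce m f ↔ IsGalerkinMode m f ∧ Torus.HasZeroMean f := Iff.rfl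

/-- The block of the crux at `(E, ε₀, G)`: energy cap, work floor, enstrophy cap. -/
def window (f : 𝕋³ → E³) (E ε₀ : ℝ) (G : ℝ≥0) : Set (𝕋³ → E³) :=
  {u | Torus.kineticEnergy u ≤ E ∧ ε₀ ≤ ∫ x, inner ℝ (f x) (u x) ∧ Torus.eGradNormSq u ≤ (G : ℝ≥0∞)}

/-- **Landing decl of the line.** For every `0 < ν ≤ ν₀` there are `G`, `N₀` such that every level `N ≥ N₀` has a
nonempty set `S` of Galerkin modes of order `N`, forward invariant under the Galerkin semiflow of order `N`, contained
in the window. -/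
def WindowInvariantSets : Prop :=
  ∃ (m : ℕ) (f : 𝕋³ → E³), IsTrigPolyForce m f ∧ ∃ (E ε₀ ν₀ : ℝ), 0 < ε₀ ∧ 0 < ν₀ ∧
    ∀ ν : ℝ, 0 < ν → ν ≤ ν₀ → ∃ (G : ℝ≥0) (N₀ : ℕ), ∀ N : ℕ, N₀ ≤ N →
      ∃ S : Set (𝕋³ → E³), S.Nonempty ∧ (∀ a ∈ S, IsGalerkinMode N a) ∧
        (∀ a ∈ S, ∀ t : ℝ, 0 ≤ t → Torus.galerkinFlow ν f N t a ∈ S) ∧ S ⊆ window f E ε₀ G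

/-- **Frozen arm, semiflow form**: a loud bounded FIXED POINT of the Galerkin semiflow at every level `N ≥ N₀(ν)`,
for all `0 < ν ≤ ν₀` (no enstrophy clause: it is automatic). -/
def FrozenLoudAllLevels : Prop :=
  ∃ (m : ℕ) (f : 𝕋³ → E³), IsTrigPolyForce m f ∧ ∃ (E ε₀ ν₀ : ℝ), 0 < ε₀ ∧ 0 < ν₀ ∧
    ∀ ν : ℝ, 0 < ν → ν ≤ ν₀ → ∃ N₀ : ℕ, ∀ N : ℕ, N₀ ≤ N →
      ∃ U : 𝕋³ → E³, IsGalerkinMode N U ∧ (∀ t : ℝ, 0 ≤ t → Torus.galerkinFlow ν f N t U = U) ∧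
        Torus.kineticEnergy U ≤ E ∧ ε₀ ≤ ∫ x, inner ℝ (f x) (U x)

/-- **Frozen arm, steady-state form (THE BET of the line)**: for every `0 < ν ≤ ν₀` and every level `N ≥ N₀(ν)` a
mean-zero steady Galerkin state of order `N` — a Galerkin mode solving the tested steady Galerkin equations
`∫ ⟪U,(U·∇)a⟫ + ν⟪U,Δa⟫ + ⟪f,a⟫ = 0` against every Galerkin mode `a` of order `N` (Temam 1979 Ch. II (1.25); the
bracket of the sibling cruxes `MirrorVariety.GalerkinSteadyZerothLaw` / `TaylorGreenLoudGalerkinStates`) — with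
`kineticEnergy U ≤ E` and work `(f,U) ≥ ε₀`, the constants `E, ε₀` fixed BEFORE `ν`. -/
def SteadyLoudAllLevels : Prop :=
  ∃ (m : ℕ) (f : 𝕋³ → E³), IsTrigPolyForce m f ∧ ∃ (E ε₀ ν₀ : ℝ), 0 < ε₀ ∧ 0 < ν₀ ∧
    ∀ ν : ℝ, 0 < ν → ν ≤ ν₀ → ∃ N₀ : ℕ, ∀ N : ℕ, N₀ ≤ N →
      ∃ U : 𝕋³ → E³, IsGalerkinMode N U ∧ Torus.HasZeroMean U ∧
        (∀ a : 𝕋³ → E³, IsGalerkinMode N a →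
          ∫ x, (⟪U x, Torus.convect U a x⟫_ℝ + ν * ⟪U x, Torus.laplacian a x⟫_ℝ + ⟪f x, a x⟫_ℝ) = 0) ∧
        Torus.kineticEnergy U ≤ E ∧ ε₀ ≤ ∫ x, inner ℝ (f x) (U x)

/-! ## §1 Registered stubs -/

/-- **stub (THE BET).** Loud bounded mean-zero steady Galerkin states at every level `N ≥ N₀(ν)`, every `0 < ν ≤ ν₀`. -/
theorem stub_steadyLoudAllLevels : SteadyLoudAllLevels := by
  sorry

/-- **stub (transfer, M).** A steady Galerkin state of order `N` (a Galerkin mode solving the tested steady Galerkin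
equations) is an equilibrium of the Galerkin semiflow `Torus.galerkinFlow ν f N` (`ν ≥ 0`, `f ∈ L²`): the tested
equations say `galerkinRHS = 0` at `Û|_{≤N}` (test with the field of the residual), and the constant coefficient curve is
then THE solution of the Galerkin ODE (uniqueness, `IsGalerkinODESolution.galerkinCoeffFlow_eq`); any real `ν`. -/
theorem stub_steadyFixedPoint {ν : ℝ} {N : ℕ} {f U : 𝕋³ → E³} (hf : MemLp f 2 volume)
    (hU : IsGalerkinMode N U)
    (hsteady : ∀ a : 𝕋³ → E³, IsGalerkinMode N a →
      ∫ x, (⟪U x, Torus.convect U a x⟫_ℝ + ν * ⟪U x, Torus.laplacian a x⟫_ℝ + ⟪f x, a x⟫_ℝ) = 0)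
    {t : ℝ} (ht : 0 ≤ t) : Torus.galerkinFlow ν f N t U = U :=
  -- LANDED: p102267, Theorems/WazewskiBlockUniformGalerkinTrapSteadyFixedPoint.lean
  Theorems.UniformGalerkinTrap.stub_steadyFixedPoint hf hU hsteady ht

/-! ## §2 Proved plumbing -/

/-- Frozen power identity on a fixed point of the Galerkin semiflow: `ν‖∇U‖² = (f, U)`
(the exact energy identity of `galerkinFlow_clauses` on the constant orbit over `[0,1]`). -/
theorem frozen_power_identity {m N : ℕ} {f U : 𝕋³ → E³} {ν : ℝ} (hf : IsTrigPolyForce m f) (hν : 0 < ν)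
    (hU : IsGalerkinMode N U) (hfix : ∀ t : ℝ, 0 ≤ t → Torus.galerkinFlow ν f N t U = U) :
    Torus.eGradNormSq U ≠ ⊤ ∧ ν * (Torus.eGradNormSq U).toReal = ∫ x, inner ℝ (f x) (U x) := by
  have hf2 : MemLp f 2 volume := hf.1.1.memLp 2
  obtain ⟨-, -, -, -, henergy⟩ := hU.galerkinFlow_clauses (ν := ν) hν.le hf2
  have htop : Torus.eGradNormSq U ≠ ⊤ := (Torus.eGradNormSq_lt_top hU.isSmooth).ne
  refine ⟨htop, ?_⟩
  have h := henergy 0 1 le_rfl zero_le_one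
  rw [hfix 1 zero_le_one, hfix 0 le_rfl] at h
  have hlin : (∫⁻ τ in Ioo (0:ℝ) 1, Torus.eGradNormSq (Torus.galerkinFlow ν f N τ U)) =
      Torus.eGradNormSq U := by
    rw [setLIntegral_congr_fun measurableSet_Ioo (fun τ hτ => by rw [hfix τ hτ.1.le]),
      setLIntegral_const, Real.volume_Ioo]
    simp
  have hint : (∫ τ in (0:ℝ)..1, ∫ x, inner ℝ (f x) (Torus.galerkinFlow ν f N τ U x)) =
      ∫ x, inner ℝ (f x) (U x) := by
    rw [intervalIntegral.integral_congr (g := fun _ => ∫ x, inner ℝ (f x) (U x)) (fun τ hτ => ?_)]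
    · simp
    · have hτ0 : 0 ≤ τ := by
        rw [Set.uIcc_of_le zero_le_one] at hτ
        exact hτ.1
      simp only [hfix τ hτ0]
  rw [hlin, hint] at h
  linarith

/-- Cauchy–Schwarz for the work: `(f,U) ≤ ‖f‖₂ · √(2·KE(U))`. -/
theorem work_le {f U : 𝕋³ → E³} (hf : Torus.IsSmooth f) (hU : Torus.IsSmooth U) :
    ∫ x, inner ℝ (f x) (U x) ≤ Real.sqrt (∫ x, ‖f x‖ ^ 2) * Real.sqrt (2 * Torus.kineticEnergy U) := by
  have h := abs_integral_inner_le_sqrt_mul_sqrt (μ := volume) (hf.memLp 2) (hU.memLp 2)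
  have h2 : 2 * Torus.kineticEnergy U = ∫ x, ‖U x‖ ^ 2 := by
    unfold Torus.kineticEnergy; ring
  rw [h2]
  exact (le_abs_self _).trans h

/-- **Frozen faces**: loud bounded fixed points at every level give window-invariant singletons with the AUTOMATIC,
`N`-uniform cap `G(ν) = ‖f‖₂ √(2E) / ν`. -/
theorem windowInvariantSets_of_frozen : FrozenLoudAllLevels → WindowInvariantSets := by
  rintro ⟨m, f, hf, E, ε₀, ν₀, hε₀, hν₀, h⟩
  refine ⟨m, f, hf, E, ε₀, ν₀, hε₀, hν₀, fun ν hν hνle => ?_⟩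
  obtain ⟨N₀, hN⟩ := h ν hν hνle
  -- the N-uniform cap G(ν) = ‖f‖₂ √(2E) / ν
  refine ⟨(Real.sqrt (∫ x, ‖f x‖ ^ 2) * Real.sqrt (2 * E) / ν).toNNReal, N₀, fun N hN₀ => ?_⟩
  obtain ⟨U, hU, hfix, hKE, hW⟩ := hN N hN₀
  refine ⟨{U}, Set.singleton_nonempty U, fun a ha => by rw [Set.mem_singleton_iff.mp ha]; exact hU,
    fun a ha t ht => ?_, fun a ha => ?_⟩
  · rw [Set.mem_singleton_iff.mp ha, Set.mem_singleton_iff, hfix t ht]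
  · rw [Set.mem_singleton_iff.mp ha]
    refine ⟨hKE, hW, ?_⟩
    obtain ⟨htop, hpow⟩ := frozen_power_identity hf hν hU hfix
    have hwork := work_le hf.1.1 hU.isSmooth
    have hE : 2 * Torus.kineticEnergy U ≤ 2 * E := by linarith
    have h1 : (Torus.eGradNormSq U).toReal ≤ Real.sqrt (∫ x, ‖f x‖ ^ 2) * Real.sqrt (2 * E) / ν := by
      rw [le_div_iff₀ hν]
      calc (Torus.eGradNormSq U).toReal * ν = ν * (Torus.eGradNormSq U).toReal := mul_comm _ _
        _ = ∫ x, inner ℝ (f x) (U x) := hpow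
        _ ≤ Real.sqrt (∫ x, ‖f x‖ ^ 2) * Real.sqrt (2 * Torus.kineticEnergy U) := hwork
        _ ≤ Real.sqrt (∫ x, ‖f x‖ ^ 2) * Real.sqrt (2 * E) := by gcongr
    show Torus.eGradNormSq U ≤ ENNReal.ofReal (Real.sqrt (∫ x, ‖f x‖ ^ 2) * Real.sqrt (2 * E) / ν)
    rw [← ENNReal.ofReal_toReal htop]
    exact ENNReal.ofReal_le_ofReal h1

/-- **Steady ⇒ frozen** (through the transfer stub `stub_steadyFixedPoint`). -/
theorem frozen_of_steady : SteadyLoudAllLevels → FrozenLoudAllLevels := by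
  rintro ⟨m, f, hf, E, ε₀, ν₀, hε₀, hν₀, h⟩
  refine ⟨m, f, hf, E, ε₀, ν₀, hε₀, hν₀, fun ν hν hνle => ?_⟩
  obtain ⟨N₀, hN⟩ := h ν hν hνle
  refine ⟨N₀, fun N hN₀ => ?_⟩
  obtain ⟨U, hU, -, hsteady, hKE, hW⟩ := hN N hN₀
  exact ⟨U, hU, fun t ht => stub_steadyFixedPoint (hf.1.1.memLp 2) hU hsteady ht, hKE, hW⟩

/-! ## §3 Composition: the registered stubs prove the crux BY NAME -/

/-- **Composition of the line `SketchIdeator1` (arm β).** The bet gives steady states, hence frozen fixed points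
(`frozen_of_steady`, through the landed `stub_steadyFixedPoint`), hence window-invariant singletons with the automatic cap
(`windowInvariantSets_of_frozen`); any point of a window-invariant set of Galerkin modes has a trapped forward orbit carrying
the crux's clause block (`IsGalerkinMode.galerkinFlow_clauses`).  This is the ONLY theorem of the file concluding the crux
(the gate takes the first such theorem as the skeleton); the landing implication `WindowInvariantSets → crux` is
its last eight lines, and the converse (crux ⇔ `WindowInvariantSets`) is landed separately as
`Theorems/WazewskiBlockUniformGalerkinTrapLandingEquivalence.lean`. -/
theorem UniformGalerkinTrap_of : Theses.WazewskiBlock.UniformGalerkinTrap := by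
  have hWIS : WindowInvariantSets := windowInvariantSets_of_frozen (frozen_of_steady stub_steadyLoudAllLevels)
  obtain ⟨m, f, ⟨hf, hmean⟩, E, ε₀, ν₀, hε₀, hν₀, h⟩ := hWIS
  refine ⟨m, f, hf, hmean, E, ε₀, ν₀, hε₀, hν₀, fun ν hν hνle => ?_⟩
  obtain ⟨G, N₀, hN⟩ := h ν hν hνle
  refine ⟨G, N₀, fun N hN₀ => ?_⟩
  obtain ⟨S, ⟨a, ha⟩, hmode, hinv, hwin⟩ := hN N hN₀
  have hf2 : MemLp f 2 volume := (hf.1).memLp 2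
  obtain ⟨-, hcont, hslice, htest, henergy⟩ := (hmode a ha).galerkinFlow_clauses (ν := ν) hν.le hf2
  refine ⟨fun t => Torus.galerkinFlow ν f N t a, ⟨hcont, fun t ht => hslice t ht,
    fun b hb s t hs hst => htest b hb s t hs hst, henergy⟩, fun t ht => ?_⟩
  exact hwin (hinv a ha t ht)

end Summit.AnomalousDissipation.AnomalousDissipation.Cruxes.UniformGalerkinTrap.SketchIdeator1

end
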